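import Literature.AlgebraicGeometry.Resolution.RegularQuotientIdeal
import Literature.AlgebraicGeometry.Resolution.StrictNormalCrossingsOpen
import Mathlib.RingTheory.Nakayama
import HarnessLib

/-!
# [OURS · L1 W4.5(b) · EL♮] LIFT-50 LOCAL CORE: when does a closed subscheme `X` of the special fibre lift, locally at a point,
# to a REGULAR `O`-flat closed subscheme of the ambient? — ring form of the common core of the two residual doors
# (E-comp) / (E-nn) of kill test #50 (crux `EquisingularLiftNat` = stmt-ResolutionOfSingularities-20038; PARENT ≥ 4 band / #50 K5-BMY)

HONEST FRAMING. OURS (cell res-hironaka, crux chain w45b, slot W4.5(b)); NOT a statement of any manuscript; replaces the role of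
NOTHING in the manuscript; AI-written, AI review is weaker than expert review. Helper `--supports stmt-ResolutionOfSingularities-20038
--as helper`. Object (ε) «LIFT-50 = the COMMON CORE» named by res-L1-w45b-plan-1 (NAMING 20:00:47Z, RULING-8 20:28:31Z); memo
`L/res-L1-w45b-lead-1/LIFT50-CORE.md` (res-L1-w45b-lead-1 gen 8).

THE SITUATION. `A = 𝒪_{P,x}` is the (regular) local ring of the current stage `P → Spec O` at a point `x` of the special fibre
`F = V(ϖ)`; a closed subscheme `X ⊂ F` through `x` is an ideal `I ∋ ϖ` of `A`. A pure nose (or any centre) with special fibre `X`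
near `x` is an ideal `J ≤ I` with `A ⧸ J` a regular local ring (the centre is regular), `ϖ ∉ J` (the centre is `O`-flat: `A ⧸ J` is a
domain, so `ϖ` is then a non-zero-divisor) and `J + (ϖ) = I` (its special fibre is `X`, scheme-theoretically). THE THEOREMS:

* `not_mem_mul_of_sup_span_eq` — NECESSITY (any local ring, Nakayama): such a `J` exists ⟹ `ϖ ∉ 𝔪·I`, i.e. `ϖ` is a MINIMAL
  GENERATOR of `I_X ⊂ 𝒪_{P,x}`. (For `I = 𝔪`, a section through `x`: `ϖ ∉ 𝔪²` = «sections avoid bad points», tree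
  `…NatBadLocus`; in general the condition says `X ↪ F` needs one equation FEWER than `X ↪ P`.)
* `exists_lift_of_span_range` — SUFFICIENCY, regular case (regular `A`): `I = (f₁, …, f_c)` with independent differentials (`X`
  regular at `x`) and `ϖ ∈ I ∖ 𝔪·I` ⟹ dropping the member of the family carrying a unit coefficient of `ϖ` gives a regular `O`-flat
  local lift `J`. The SINGULAR hypersurface case and the general criterion for `X` of embedded hypersurface type (`I = J₀ + (h)`,
  `A ⧸ J₀` regular: companion configurations, CI-pinched avatars, …) are in part 2, `…NatLiftCoreLocalHypersurface`
  (`exists_regular_flat_lift`, `exists_regular_flat_lift_iff`).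
* `mem_mul_of_isRegularLocalRing_quotient_of_mem_sq` — at a BAD point (`ϖ ∈ 𝔪²`) a subscheme `X` that is REGULAR at `x` never lifts
  (`I ∩ 𝔪² = 𝔪 I` for `I` generated by regular parameters); only singular `X` can lift through bad points.
* `map_mem_mul_of_mem_mul` — PERSISTENCE: `ϖ ∈ 𝔪_x·I_X` passes to every point `x″ ↦ x` of a later stage and every `X″ ∋ x″` whose ideal
  contains the image of `I_X` (e.g. the strict transform): once non-liftable, non-liftable forever above.

So LOCAL LIFTABILITY of a hypersurface-type `X ⊂ F` at `x` ⟺ `ϖ ∉ 𝔪_x I_{X,x}` ⟺ `μ(I_{X ⊂ F,x}) = μ(I_{X ⊂ P,x}) − 1`; automatic at GOOD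
points (`ϖ ∉ 𝔪²`), a genuine condition at BAD ones. Memo LIFT50-CORE.md evaluates it on the doors of #50 (K2's CI pinching move is
`Y`-transversal ⇒ `ϖ ∈ I_C + 𝔪 I_S` ⇒ `ϖ ∈ 𝔪″ I_{S″}` along the whole pinch curve ⇒ no pure nose over that avatar at any later stage).

References: Matsumura, Commutative Ring Theory, Thm. 14.2 [Matsumura1987] (regular quotients ⟷ independent differentials; tree
`RegularQuotientIdeal.lean`, `StrictNormalCrossingsOpen.lean`); Nakayama (Mathlib `Submodule.le_of_le_smul_of_le_jacobson_bot`). [folklore]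
-/

set_option linter.dupNamespace false -- mandated namespace `Summit.<Summit>.<Problem>` of this single-conjunct summit

universe u

open IsLocalRing Module
open Literature.AlgebraicGeometry.Resolution

namespace Summit.ResolutionOfSingularities.ResolutionOfSingularities.Cruxes.EquisingularLiftNat.Sections

namespace LiftCore

/-! ## Necessity: `ϖ` is a minimal generator of `I_X` (any local ring) -/

section Necessity

variable {A : Type u} [CommRing A] [IsLocalRing A]

/-- **LIFT-50 local core, necessity (Nakayama).** In a local ring, if `J + (ϖ) = I` with `I` finitely generated and `ϖ ∉ J`, then
`ϖ ∉ 𝔪·I`: the special-fibre equation `ϖ` is a minimal generator of the ideal `I` of the special fibre of the flat lift `V(J)`.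
OURS. [folklore] -/
theorem not_mem_mul_of_sup_span_eq {I J : Ideal A} (hI : I.FG) {ϖ : A} (hJ : J ⊔ Ideal.span {ϖ} = I) (hϖJ : ϖ ∉ J) :
    ϖ ∉ maximalIdeal A * I := by
  intro hmem
  have hϖI : ϖ ∈ I := hJ ▸ Ideal.mem_sup_right (Ideal.mem_span_singleton_self ϖ)
  have hle : I ≤ J ⊔ maximalIdeal A • I := by
    rw [Ideal.smul_eq_mul, ← hJ]
    refine sup_le (le_sup_left.trans (sup_le_sup_left (by rw [hJ]) _)) ?_
    rw [hJ]
    exact (Ideal.span_singleton_le_iff_mem _).mpr hmem |>.trans le_sup_right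
  have hIJ : I ≤ J :=
    Submodule.le_of_le_smul_of_le_jacobson_bot hI (IsLocalRing.maximalIdeal_le_jacobson ⊥) hle
  exact hϖJ (hIJ hϖI)

/-- The same with the hypotheses packaged as «a regular `O`-flat lift exists» (Noetherian local ring). OURS. [folklore] -/
theorem not_mem_mul_of_exists_lift [IsNoetherianRing A] {I : Ideal A} {ϖ : A}
    (h : ∃ J ≤ I, ϖ ∉ J ∧ J ⊔ Ideal.span {ϖ} = I) : ϖ ∉ maximalIdeal A * I := by
  obtain ⟨J, -, hϖJ, hJ⟩ := h
  exact not_mem_mul_of_sup_span_eq (IsNoetherian.noetherian I) hJ hϖJ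

/-- Sections: for `I = 𝔪` (the reduced point `x`), the criterion `ϖ ∉ 𝔪·I` reads `ϖ ∉ 𝔪²` — `x` is a GOOD point
(tree `…NatBadLocus.varpiGerm_not_mem_sq_of_section`). OURS. [folklore] -/
theorem not_mem_sq_of_sup_span_eq_maximalIdeal [IsNoetherianRing A] {J : Ideal A} {ϖ : A}
    (hJ : J ⊔ Ideal.span {ϖ} = maximalIdeal A) (hϖJ : ϖ ∉ J) : ϖ ∉ maximalIdeal A ^ 2 := by
  rw [pow_two]
  exact not_mem_mul_of_sup_span_eq (IsNoetherian.noetherian _) hJ hϖJ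

end Necessity

/-! ## Persistence upward -/

section Persistence

variable {A B : Type u} [CommRing A] [CommRing B] [IsLocalRing A] [IsLocalRing B]

/-- **PERSISTENCE.** For a local homomorphism `φ : 𝒪_{P′,x′} → 𝒪_{P″,x″}` (a later stage, `x″ ↦ x′`) and ideals `I′`, `I″` with
`φ(I′) ⊆ I″` (e.g. `I″` the ideal of the strict transform of `X′ = V(I′)`): `ϖ ∈ 𝔪′·I′ ⟹ φ ϖ ∈ 𝔪″·I″`. With the necessity
theorem: once the avatar fails the criterion at `x′`, NO regular `O`-flat subscheme of ANY later stage has the avatar as its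
special fibre near a point over `x′`. OURS. [folklore] -/
theorem map_mem_mul_of_mem_mul (φ : A →+* B) [IsLocalHom φ] {I' : Ideal A} {I'' : Ideal B}
    (hI : I'.map φ ≤ I'') {ϖ : A} (hϖ : ϖ ∈ maximalIdeal A * I') : φ ϖ ∈ maximalIdeal B * I'' := by
  have h1 : (maximalIdeal A * I').map φ ≤ maximalIdeal B * I'' := by
    rw [Ideal.map_mul]
    exact Ideal.mul_mono (((IsLocalRing.local_hom_TFAE φ).out 0 2).mp ‹_›) hI
  exact h1 (Ideal.mem_map_of_mem φ hϖ)

end Persistence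

/-! ## Sufficiency in a regular local ring -/

section Sufficiency

variable {R : Type u} [CommRing R] [IsRegularLocalRing R]

/-- Bridge: if `f₁, …, f_c ∈ 𝔪` have linearly independent differentials and `Σ αᵢ fᵢ ∈ 𝔪²`, then every `αᵢ ∈ 𝔪`. [folklore] -/
theorem mem_maximalIdeal_of_sum_mul_mem_sq {c : ℕ} (f : Fin c → R) (hf : ∀ i, f i ∈ maximalIdeal R)
    (hli : LinearIndependent (ResidueField R) fun i => (maximalIdeal R).toCotangent ⟨f i, hf i⟩)
    (α : Fin c → R) (hα : ∑ i, α i * f i ∈ maximalIdeal R ^ 2) : ∀ i, α i ∈ maximalIdeal R := by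
  have hmem : ∑ i, α i * f i ∈ maximalIdeal R :=
    Ideal.sum_mem _ fun i _ => Ideal.mul_mem_left _ _ (hf i)
  have heq : (⟨∑ i, α i * f i, hmem⟩ : maximalIdeal R) = ∑ i, α i • (⟨f i, hf i⟩ : maximalIdeal R) := by
    apply Subtype.ext
    simp only [AddSubmonoidClass.coe_finsetSum, SetLike.val_smul, smul_eq_mul]
  have h0 : (maximalIdeal R).toCotangent ⟨∑ i, α i * f i, hmem⟩ = 0 :=
    (Ideal.toCotangent_eq_zero _ _).mpr hα
  rw [heq, map_sum] at h0
  simp_rw [LinearMap.map_smul_of_tower] at h0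
  have h0' : ∑ i, (residue R (α i)) • (maximalIdeal R).toCotangent ⟨f i, hf i⟩ = 0 := by
    rw [← h0]
    refine Finset.sum_congr rfl fun i _ => ?_
    exact algebraMap_smul (ResidueField R) (α i) _
  intro i
  have := (Fintype.linearIndependent_iff.mp hli) (fun i => residue R (α i)) h0' i
  exact (residue_eq_zero_iff (α i)).mp this

/-- If all coefficients lie in `𝔪` then `Σ bᵢ gᵢ ∈ 𝔪·I` for `gᵢ ∈ I`. [folklore] -/
theorem sum_mul_mem_mul {ι : Type*} (s : Finset ι) {I : Ideal R} (b g : ι → R) (hb : ∀ i ∈ s, b i ∈ maximalIdeal R)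
    (hg : ∀ i ∈ s, g i ∈ I) : ∑ i ∈ s, b i * g i ∈ maximalIdeal R * I :=
  Ideal.sum_mem _ fun i hi => Ideal.mul_mem_mul (hb i hi) (hg i hi)

/-- **Regular case.** `I = (f₁, …, f_c)` with independent differentials (so `X = V(I)` is regular at `x`), `ϖ ∈ I ∖ 𝔪 I`: writing
`ϖ = Σ bᵢ fᵢ`, some `bᵢ₀` is a unit, and `J := (fᵢ : i ≠ i₀)` is a regular `O`-flat lift: `A ⧸ J` regular, `ϖ ∉ J`, `J + (ϖ) = I`.
OURS. [folklore] -/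
theorem exists_lift_of_span_range {c : ℕ} (f : Fin c → R) (hf : ∀ i, f i ∈ maximalIdeal R)
    (hli : LinearIndependent (ResidueField R) fun i => (maximalIdeal R).toCotangent ⟨f i, hf i⟩)
    {ϖ : R} (hϖI : ϖ ∈ Ideal.span (Set.range f)) (hϖ : ϖ ∉ maximalIdeal R * Ideal.span (Set.range f)) :
    ∃ J ≤ Ideal.span (Set.range f), IsRegularLocalRing (R ⧸ J) ∧ ϖ ∉ J ∧
      J ⊔ Ideal.span {ϖ} = Ideal.span (Set.range f) := by
  classical
  set I := Ideal.span (Set.range f) with hIdef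
  have hfI : ∀ i, f i ∈ I := fun i => Ideal.subset_span ⟨i, rfl⟩
  obtain ⟨b, hb⟩ := Ideal.mem_span_range_iff_exists_fun.mp hϖI
  -- some coefficient is a unit
  obtain ⟨i₀, hi₀⟩ : ∃ i₀, b i₀ ∉ maximalIdeal R := by
    by_contra hall
    push Not at hall
    exact hϖ (hb ▸ sum_mul_mem_mul _ b f (fun i _ => hall i) (fun i _ => hfI i))
  have hu : IsUnit (b i₀) := (IsLocalRing.notMem_maximalIdeal).mp hi₀
  let T : Set (Fin c) := {i | i ≠ i₀}
  refine ⟨Ideal.span (f '' T), Ideal.span_mono (Set.image_subset_range _ _),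
    isRegularLocalRing_quotient_span_image_of_linearIndependent_toCotangent f hf hli T, ?_, ?_⟩
  · -- `ϖ ∉ J`: otherwise `f i₀ ∈ J`, contradicting independence
    intro hϖJ
    have hsplit : b i₀ * f i₀ + ∑ i ∈ Finset.univ.erase i₀, b i * f i = ϖ := by
      have := Finset.add_sum_erase Finset.univ (fun i => b i * f i) (Finset.mem_univ i₀)
      simpa only [hb] using this
    have hrest : ∑ i ∈ Finset.univ.erase i₀, b i * f i ∈ Ideal.span (f '' T) :=
      Ideal.sum_mem _ fun i hi =>
        Ideal.mul_mem_left _ _ (Ideal.subset_span ⟨i, Finset.ne_of_mem_erase hi, rfl⟩)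
    have hbf : b i₀ * f i₀ ∈ Ideal.span (f '' T) := by
      have : b i₀ * f i₀ = ϖ - ∑ i ∈ Finset.univ.erase i₀, b i * f i := by rw [← hsplit]; ring
      rw [this]
      exact Ideal.sub_mem _ hϖJ hrest
    have hfi₀ : f i₀ ∈ Ideal.span (f '' T) := by
      have : f i₀ = ↑hu.unit⁻¹ * (b i₀ * f i₀) := by
        rw [← mul_assoc, IsUnit.val_inv_mul, one_mul]
      rw [this]
      exact Ideal.mul_mem_left _ _ hbf
    exact not_mem_span_image_of_linearIndependent_toCotangent f hf hli i₀ T (fun h => h rfl) hfi₀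
  · -- `J + (ϖ) = I`
    apply le_antisymm
    · exact sup_le (Ideal.span_mono (Set.image_subset_range _ _))
        ((Ideal.span_singleton_le_iff_mem _).mpr hϖI)
    · rw [Ideal.span_le]
      rintro _ ⟨i, rfl⟩
      by_cases hi : i = i₀
      · subst hi
        have hsplit : b i * f i + ∑ j ∈ Finset.univ.erase i, b j * f j = ϖ := by
          have := Finset.add_sum_erase Finset.univ (fun j => b j * f j) (Finset.mem_univ i)
          simpa only [hb] using this
        have hrest : ∑ j ∈ Finset.univ.erase i, b j * f j ∈ Ideal.span (f '' T) ⊔ Ideal.span {ϖ} :=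
          Ideal.mem_sup_left (Ideal.sum_mem _ fun j hj =>
            Ideal.mul_mem_left _ _ (Ideal.subset_span ⟨j, Finset.ne_of_mem_erase hj, rfl⟩))
        have hbf : b i * f i ∈ Ideal.span (f '' T) ⊔ Ideal.span {ϖ} := by
          have : b i * f i = ϖ - ∑ j ∈ Finset.univ.erase i, b j * f j := by rw [← hsplit]; ring
          rw [this]
          exact Ideal.sub_mem _ (Ideal.mem_sup_right (Ideal.mem_span_singleton_self ϖ)) hrest
        have : f i = ↑hu.unit⁻¹ * (b i * f i) := by
          rw [← mul_assoc, IsUnit.val_inv_mul, one_mul]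
        change f i ∈ Ideal.span (f '' T) ⊔ Ideal.span {ϖ}
        rw [this]
        exact Ideal.mul_mem_left _ _ hbf
      · exact Ideal.mem_sup_left (Ideal.subset_span ⟨i, hi, rfl⟩)

/-- **Regular subschemes never lift through BAD points.** If `R ⧸ I` is regular (`X` regular at `x`) and `ϖ ∈ I ∩ 𝔪²` (`x` is a bad
point of the stage), then `ϖ ∈ 𝔪·I` — so by `not_mem_mul_of_sup_span_eq` no regular `O`-flat subscheme has special fibre `X` near
`x`: a regular centre through a bad point has SINGULAR special fibre there (tree `…NatBadLocus`: sections avoid bad points).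
OURS. [folklore] -/
theorem mem_mul_of_isRegularLocalRing_quotient_of_mem_sq {I : Ideal R} (hI : I ≤ maximalIdeal R)
    [IsRegularLocalRing (R ⧸ I)] {ϖ : R} (hϖI : ϖ ∈ I) (hϖ2 : ϖ ∈ maximalIdeal R ^ 2) : ϖ ∈ maximalIdeal R * I := by
  classical
  obtain ⟨c, f, hfG, hspan, hli⟩ :=
    exists_span_eq_of_isRegularLocalRing_quotient hI (I : Set R) (Ideal.span_eq I)
  have hf : ∀ i, f i ∈ maximalIdeal R := fun i => hI (hspan ▸ Ideal.subset_span ⟨i, rfl⟩)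
  have hli : LinearIndependent (ResidueField R) fun i => (maximalIdeal R).toCotangent ⟨f i, hf i⟩ := hli
  rw [← hspan] at hϖI ⊢
  obtain ⟨b, hb⟩ := Ideal.mem_span_range_iff_exists_fun.mp hϖI
  have hbm := mem_maximalIdeal_of_sum_mul_mem_sq f hf hli b (hb ▸ hϖ2)
  rw [← hb]
  exact sum_mul_mem_mul _ b f (fun i _ => hbm i) (fun i _ => Ideal.subset_span ⟨i, rfl⟩)

/-- **BAD POINT ⟹ every regular `O`-flat centre through it has SINGULAR special fibre there** (all dimensions; generalises
«sections avoid bad points», tree `…NatBadLocus`): in a regular local ring `R = 𝒪_{P,x}` with `ϖ ∈ 𝔪²` (`x` bad), if `J ≤ 𝔪` has `R ⧸ J` regular (the centre)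
and `ϖ ∉ J` (the centre is `O`-flat at `x`), then `R ⧸ (J + (ϖ))` — the local ring of the centre's special fibre — is NOT regular. Proof: were it regular,
`mem_mul_of_isRegularLocalRing_quotient_of_mem_sq` would give `ϖ ∈ 𝔪·(J + (ϖ))`, contradicting the Nakayama necessity
`not_mem_mul_of_sup_span_eq`. (Appended 2026-08-27, same seat; OURS.) [folklore] -/
theorem not_isRegularLocalRing_quotient_sup_span_of_mem_sq {J : Ideal R} (hJ : J ≤ maximalIdeal R) {ϖ : R}
    (hϖm : ϖ ∈ maximalIdeal R) (hϖ2 : ϖ ∈ maximalIdeal R ^ 2) (hϖJ : ϖ ∉ J) :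
    ¬ IsRegularLocalRing (R ⧸ (J ⊔ Ideal.span {ϖ})) := by
  intro hreg
  have hI : J ⊔ Ideal.span {ϖ} ≤ maximalIdeal R := sup_le hJ ((Ideal.span_singleton_le_iff_mem _).mpr hϖm)
  have hϖI : ϖ ∈ J ⊔ Ideal.span {ϖ} := Ideal.mem_sup_right (Ideal.mem_span_singleton_self ϖ)
  have hmem := mem_mul_of_isRegularLocalRing_quotient_of_mem_sq hI hϖI hϖ2
  exact not_mem_mul_of_sup_span_eq (IsNoetherian.noetherian _) rfl hϖJ hmem

end Sufficiency

end LiftCore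

end Summit.ResolutionOfSingularities.ResolutionOfSingularities.Cruxes.EquisingularLiftNat.Sections
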